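import Mathlib

/-!
# Hermitianisation of the fuzzy quantum eigenvalue detector (DEQ-A177, Prop. A177.1, receipt)

HONEST FRAMING: instance-level adjudication of specific advantage claims; no claim about
BQP vs BPP or the summit.

Lane receipt for unit pub-qadeq-deq-2 (gen 29, DEQ-A177 v1.0), filed through the gate by the cell lead
(pub-qadeq-harvest-1 gen 22) at deq-2's request (HANDOFF deq-2 block 34a); staging copy
`pub-qadeq-harvest-1/scratch-staging/FQEDHermitianisation.lean`.

Context (cell pub-qadeq, claim A-177 = Zhang–Zhang–He–Yuan, "Exponential Quantum Advantages for
Practical Non-Hermitian Eigenproblems", Phys. Rev. Lett. 135, 140601 (2025) = arXiv:2401.12091v3): the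
paper's fuzzy quantum eigenvalue detector thresholds `C(μ) = σ_min(A − μI)` and uses
`C(μ) ≤ min_j |μ − λ_j|` (p0004). DEQ-A177 Prop. A177.1 observes that the detector's predicate is a
guided GROUND-ENERGY predicate of the HERMITIAN positive semidefinite matrix
`H_μ = (A − μI)ᴴ (A − μI)`: its Rayleigh quotient at an eigenvector `v` of `A` with eigenvalue `λ` is
exactly `|λ − μ|²`, so `λ_min(H_μ) = σ_min(A − μI)² ≤ |λ − μ|²` for every eigenvalue `λ` of `A` — which is
what lets the constant-precision half of the problem be handed to the guided-local-Hamiltonian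
dequantization (Gharibian–Le Gall 2022 / Le Gall 2025, tree facts `GharibianLeGall2022_thm2`,
`LeGall2025_guidedLH_constPrecision_BPP`).

What is here (Mathlib-only, no `def`, no named fact, no `sorry`):
* `shift_mulVec_eigvec` : `(A − μ•1) v = (λ − μ) • v` for an eigenpair `A v = λ • v`;
* `hermitianisation_isHermitian` : `(A − μ•1)ᴴ (A − μ•1)` is Hermitian;
* `hermitianisation_rayleigh_nonneg` : `0 ≤ Re ⟨w, H_μ w⟩` for every `w` (positive semidefiniteness
  as a quadratic form: `⟨w, H_μ w⟩ = ‖(A − μ1) w‖²`);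
* `hermitianisation_rayleigh_eigvec` : `⟨v, H_μ v⟩ = |λ − μ|² · ⟨v, v⟩` at an eigenpair — the identity of
  Prop. A177.1;
* `exists_rayleigh_le_dist_sq` : hence for a unit eigenvector some unit vector has Rayleigh quotient
  `≤ |λ − μ|²` — the variational form of `σ_min(A − μI) ≤ |μ − λ|` (the paper's sandwich, lower half).

All `[folklore]` linear algebra; the value is the kernel-checked bookkeeping for the DEQ-A177 reduction.
-/

namespace Summit.QuantumAdvantage.Dequantization.FQEDHermitianisation

open Matrix

variable {n : Type*} [Fintype n] [DecidableEq n]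

/-- The shifted matrix `A − μ•1` acts on an eigenvector of `A` (eigenvalue `λ`) as the scalar `λ − μ`.
[folklore] -/
theorem shift_mulVec_eigvec (A : Matrix n n ℂ) (μ lam : ℂ) (v : n → ℂ)
    (hv : A *ᵥ v = lam • v) : (A - μ • (1 : Matrix n n ℂ)) *ᵥ v = (lam - μ) • v := by
  rw [sub_mulVec, hv, smul_mulVec, one_mulVec, sub_smul]

/-- The Hermitianisation `H_μ = (A − μ•1)ᴴ (A − μ•1)` is Hermitian. [folklore] -/
theorem hermitianisation_isHermitian (A : Matrix n n ℂ) (μ : ℂ) :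
    ((A - μ • (1 : Matrix n n ℂ))ᴴ * (A - μ • (1 : Matrix n n ℂ))).IsHermitian :=
  Matrix.isHermitian_conjTranspose_mul_self _

/-- The quadratic form of the Hermitianisation is the squared norm of the shifted image:
`⟨w, (Bᴴ B) w⟩ = ⟨B w, B w⟩` with `B = A − μ•1`. [folklore] -/
theorem hermitianisation_rayleigh_eq (A : Matrix n n ℂ) (μ : ℂ) (w : n → ℂ) :
    star w ⬝ᵥ (((A - μ • (1 : Matrix n n ℂ))ᴴ * (A - μ • (1 : Matrix n n ℂ))) *ᵥ w)
      = star ((A - μ • (1 : Matrix n n ℂ)) *ᵥ w) ⬝ᵥ ((A - μ • (1 : Matrix n n ℂ)) *ᵥ w) := by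
  set B := A - μ • (1 : Matrix n n ℂ)
  rw [← mulVec_mulVec, dotProduct_mulVec, ← star_mulVec]

/-- Positive semidefiniteness of `H_μ` as a quadratic form: `0 ≤ Re ⟨w, H_μ w⟩`. [folklore] -/
theorem hermitianisation_rayleigh_nonneg (A : Matrix n n ℂ) (μ : ℂ) (w : n → ℂ) :
    0 ≤ (star w ⬝ᵥ (((A - μ • (1 : Matrix n n ℂ))ᴴ * (A - μ • (1 : Matrix n n ℂ))) *ᵥ w)).re := by
  rw [hermitianisation_rayleigh_eq]
  set u := (A - μ • (1 : Matrix n n ℂ)) *ᵥ w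
  rw [dotProduct, Complex.re_sum]
  refine Finset.sum_nonneg fun i _ => ?_
  rw [Pi.star_apply, Complex.star_def, ← Complex.normSq_eq_conj_mul_self, Complex.ofReal_re]
  exact Complex.normSq_nonneg _

/-- **Prop. A177.1 (identity).** At an eigenpair `A v = λ • v`:
`⟨v, (A − μ•1)ᴴ (A − μ•1) v⟩ = |λ − μ|² · ⟨v, v⟩`. [folklore] -/
theorem hermitianisation_rayleigh_eigvec (A : Matrix n n ℂ) (μ lam : ℂ) (v : n → ℂ)
    (hv : A *ᵥ v = lam • v) :
    star v ⬝ᵥ (((A - μ • (1 : Matrix n n ℂ))ᴴ * (A - μ • (1 : Matrix n n ℂ))) *ᵥ v)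
      = ((‖lam - μ‖ ^ 2 : ℝ) : ℂ) * (star v ⬝ᵥ v) := by
  rw [hermitianisation_rayleigh_eq, shift_mulVec_eigvec A μ lam v hv, star_smul, smul_dotProduct,
    dotProduct_smul, smul_smul, smul_eq_mul, Complex.star_def, Complex.sq_norm,
    Complex.normSq_eq_conj_mul_self]

/-- **Variational consequence (`σ_min(A − μI)² ≤ |λ − μ|²`).** For a UNIT eigenvector `v` of `A` with
eigenvalue `λ`, the unit vector `v` itself has Rayleigh quotient `|λ − μ|²` in `H_μ`; hence the minimum
of the (real, nonnegative) quadratic form of `H_μ` over unit vectors — `λ_min(H_μ) = σ_min(A − μI)²` —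
is at most `|λ − μ|²` for every eigenvalue `λ` of `A`: the lower half `C(μ) ≤ min_j |μ − λ_j|` of the
paper's sandwich (Zhang–Zhang–He–Yuan 2025, p. 4), in the quadratic-form language Mathlib has.
[folklore] -/
theorem exists_rayleigh_le_dist_sq (A : Matrix n n ℂ) (μ lam : ℂ) (v : n → ℂ)
    (hv : A *ᵥ v = lam • v) (hunit : star v ⬝ᵥ v = 1) :
    ∃ w : n → ℂ, star w ⬝ᵥ w = 1 ∧
      (star w ⬝ᵥ (((A - μ • (1 : Matrix n n ℂ))ᴴ * (A - μ • (1 : Matrix n n ℂ))) *ᵥ w)).re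
        ≤ ‖lam - μ‖ ^ 2 := by
  refine ⟨v, hunit, le_of_eq ?_⟩
  rw [hermitianisation_rayleigh_eigvec A μ lam v hv, hunit, mul_one, Complex.ofReal_re]

end Summit.QuantumAdvantage.Dequantization.FQEDHermitianisation
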